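import Literature.MathematicalPhysics.QuantumFieldTheory.Balaban1983to89.B13TaxiPathBoundsLocal

/-!
# `Balaban1983to89.B13TaxiStarShapedBoxes` — T. Bałaban, *Propagators for lattice gauge theories in a background field*, Commun. Math. Phys. **99** (1985)
389–434 [Balaban1985BackgroundPropagators], (3.19) p. 393 and (3.24) p. 394 (averaging over the BLOCK `B^j(y)` along contours from its reference point),
(3.40) p. 397 («a shortest contour»), (3.35)–(3.37) p. 396 (bounds on the background CUBE BY CUBE); *Propagators and renormalization transformations for lattice
gauge theories. I*, Commun. Math. Phys. **95** (1984) 17–40 [Balaban1984PropagatorsI] (1.6) p. 18, (1.18) p. 20 (the blocks of the torus): BOXES OF THE TORUS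
WHOSE SIDES ARE AT MOST HALF THE PERIOD ARE TAXI-STAR-SHAPED towards each of their points — so the region-local word-length bounds of
`B13TaxiPathBoundsLocal` apply INSIDE A BLOCK with the per-bond bounds that hold ON THAT BLOCK.

statement-level bookkeeping ([folklore] modular arithmetic on `ZMod N`) over node00-def-Y's `Node00/OpsYTransport` and `B13TaxiPathBoundsLocal`, with citation
tags; kernel-checked; nothing here is a claim about the Yang–Mills mass gap; nothing of Bałaban's is asserted; no node is discharged; count-neutral.

WHY THIS FILE (cell `pub-ymgap`, HUMAN RULING D-0062, Track A node N10 = [Balaban1988RG2Cluster] → N06 row 17; width seat `pub-ymgap-dag-n10-w3` g5; station W2 of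
the located road's k-uniform re-read, design note bus 2026-08-28 I.38899).  `B13TaxiPathBoundsLocal` (W1) bounds a taxicab transporter by `K^{|x − x′|₁}` from a bound
`K` on the bonds based in a region `S` that is «taxi-star-shaped towards `x′`» (two displayed clauses `hSf ∕ hSb`).  THIS FILE discharges the clauses for the regions
the averaging operators use — coordinate BOXES `{y : ∀ μ, (y_μ − c_μ).val < s_μ}` of the torus `(ℤ∕N)^d` containing the target `x′`, of sides `2·s_μ ≤ N` (then
the shorter way round from a box point towards `x′_μ` never leaves the box) — and packages W1 at such boxes: `‖U(Γ_{x,x′})^{±1}‖ ≤ K^{|x − x′|₁}` for `x, x′`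
in the box from `‖U(b)^{±1}‖ ≤ K` on the bonds based IN THE BOX.  The blocks `B^j(y)` of every level are such boxes (side `L^j ≤ L^{m+K} = N∕2`).

WHAT THIS FILE PROVES (all `theorem`s; no `def`, no instance, no notation).
§1 ONE COORDINATE (`ZMod N`, `NeZero N`; two private `ZMod.val` plumbing lemmas): `val_add_natCast_lt_of_fwd` (relative positions `p, q` of `y_μ, x′_μ` in a window of width `s`, `2s ≤ N`: if the forward count
   `(q − p).val` is at most the backward count `(p − q).val` then every forward step `t ≤ (q − p).val` keeps `(p + t).val < s`), `val_sub_natCast_lt_of_bwd` (the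
   backward twin), and ★ `fwd_iff_le` (in such a window the forward count is the smaller one iff `p.val ≤ q.val`).
§2 ★ `box_taxiStarShaped_fwd` ∕ ★ `box_taxiStarShaped_bwd`: W1's clauses `hSf ∕ hSb` for the box `{y : ∀ μ, (y μ − c μ).val < s μ}` (`x′` in the box, `2·s μ ≤ N`).
§3 ★★ `norm_parTaxiV_le_pow_of_box` ∕ `_inv_` (ANY configuration `U`: per-bond bounds on the box ⟹ `‖U(Γ_{x,x′})^{±1}‖ ≤ K^{|x − x′|₁}` for `x, x′` in the box),
   and the run ∕ leg forms `norm_taxiRun_le_pow_of_box ∕ _inv_`.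
HONEST FRAMING: [folklore] bookkeeping; which boxes the road reads (the blocks of a site's own level, □̃'s neighbourhood) and the per-bond bounds there are the
next station's; nothing of Bałaban's asserted; N06 ∕ N10 NOT discharged; no registered stub proved; counts unmoved; one finite 𝕋⁴ programme at fixed ε — R4
closes the conditional finite-𝕋⁴ rung `BalabanLadder.UV` only; nothing continuum ∕ ℝ⁴ ∕ OS ∕ mass gap ∕ Clay.  0 `sorry`, 0 `def`, standard axioms.

References: [Balaban1985BackgroundPropagators] (3.3) p.391, (3.19) p.393, (3.24) p.394, (3.35)–(3.37) p.396, (3.40) p.397; [Balaban1984PropagatorsI] (1.6) p.18, (1.18) p.20;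
[Balaban1985Averaging] (52)–(55) pp.27–28.
-/

noncomputable section

namespace Literature.MathematicalPhysics.QuantumFieldTheory.Balaban1983to89.B13TaxiStarShapedBoxes

open Set
open Literature.MathematicalPhysics.QuantumFieldTheory.Balaban1983to89
open Literature.MathematicalPhysics.QuantumFieldTheory.Balaban1983to89.B9BackgroundsKLevelV1 (CfgV1)
open Literature.MathematicalPhysics.QuantumFieldTheory.Balaban1983to89.Node00
  (taxiLegV taxiRun parTaxiV iterate_shift_apply iterate_unshift_apply)
open Literature.MathematicalPhysics.QuantumFieldTheory.Balaban1983to89.B13TaxiPathBoundsLocal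

/-! ## §1. One coordinate: a window of width `s ≤ N∕2` in `ℤ∕N` -/

section Coord

variable {N : ℕ} [NeZero N]

/-- if `p.val ≤ q.val` the forward count is `(q − p).val = q.val − p.val` (plumbing). [folklore] -/
private theorem val_sub_eq_of_le {p q : ZMod N} (h : p.val ≤ q.val) : (q - p).val = q.val - p.val := ZMod.val_sub h

/-- if `q.val < p.val` the forward count is `(q − p).val = N − (p.val − q.val)` (plumbing). [folklore] -/
private theorem val_sub_eq_of_lt {p q : ZMod N} (h : q.val < p.val) : (q - p).val = N - (p.val - q.val) := by
  have hne : p - q ≠ 0 := by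
    intro h0
    have : p = q := sub_eq_zero.1 h0
    rw [this] at h; exact lt_irrefl _ h
  have h1 : (p - q).val = p.val - q.val := ZMod.val_sub h.le
  have h2 : q - p = -(p - q) := by ring
  rw [h2, ZMod.neg_val, if_neg hne, h1]

/-- ★ **THE FORWARD CASE IS THE CASE `p.val ≤ q.val`** (window of width `s`, `2s ≤ N`, `p.val, q.val < s`): the forward count is at most the backward count
iff `p.val ≤ q.val` — which way round the shortest contour of (3.40) runs inside a cube.
[cite: Balaban1985BackgroundPropagators, (3.40) p.397 («a shortest contour connecting points x and x′»), bookkeeping] -/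
theorem fwd_iff_le {s : ℕ} (hs : 2 * s ≤ N) {p q : ZMod N} (hp : p.val < s) (hq : q.val < s) :
    (q - p).val ≤ (p - q).val ↔ p.val ≤ q.val := by
  constructor
  · intro h
    rcases le_or_gt p.val q.val with hle | hlt
    · exact hle
    · rw [val_sub_eq_of_lt hlt, val_sub_eq_of_le hlt.le] at h
      omega
  · intro hle
    rcases hle.eq_or_lt with heq | hlt
    · have : p = q := ZMod.val_injective N heq
      subst this; exact le_rfl
    · rw [val_sub_eq_of_le hle, val_sub_eq_of_lt hlt]
      omega

/-- ★ **FORWARD STEPS STAY IN THE WINDOW**: `p.val, q.val < s`, `2s ≤ N`, forward count `≤` backward count, `t ≤ (q − p).val` ⟹ `(p + t).val < s` (indeed `= p.val + t ≤ q.val`).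
[cite: Balaban1985BackgroundPropagators, (3.40) p.397 (shortest contour inside the cube), bookkeeping] -/
theorem val_add_natCast_lt_of_fwd {s : ℕ} (hs : 2 * s ≤ N) {p q : ZMod N} (hp : p.val < s) (hq : q.val < s)
    (h : (q - p).val ≤ (p - q).val) {t : ℕ} (ht : t ≤ (q - p).val) : (p + (t : ZMod N)).val < s := by
  have hle : p.val ≤ q.val := (fwd_iff_le hs hp hq).1 h
  rw [val_sub_eq_of_le hle] at ht
  have htN : t < N := by omega
  have hval : (p + (t : ZMod N)).val = p.val + t := by
    rw [ZMod.val_add_of_lt, ZMod.val_natCast, Nat.mod_eq_of_lt htN]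
    rw [ZMod.val_natCast, Nat.mod_eq_of_lt htN]; omega
  omega

/-- ★ **BACKWARD STEPS STAY IN THE WINDOW**: `p.val, q.val < s`, `2s ≤ N`, forward count NOT `≤` backward count, `t ≤ (p − q).val` ⟹ `(p − t).val < s` (indeed `= p.val − t ≥ q.val`).
[cite: Balaban1985BackgroundPropagators, (3.40) p.397, bookkeeping] -/
theorem val_sub_natCast_lt_of_bwd {s : ℕ} (hs : 2 * s ≤ N) {p q : ZMod N} (hp : p.val < s) (hq : q.val < s)
    (h : ¬ (q - p).val ≤ (p - q).val) {t : ℕ} (ht : t ≤ (p - q).val) : (p - (t : ZMod N)).val < s := by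
  have hlt : q.val < p.val := by
    rcases le_or_gt p.val q.val with hle | hlt
    · exact absurd ((fwd_iff_le hs hp hq).2 hle) h
    · exact hlt
  rw [ZMod.val_sub hlt.le] at ht
  have htN : t < N := by omega
  have htv : ((t : ZMod N)).val = t := by rw [ZMod.val_natCast, Nat.mod_eq_of_lt htN]
  have hval : (p - (t : ZMod N)).val = p.val - t := by
    rw [ZMod.val_sub] <;> rw [htv]; omega
  omega

end Coord

/-! ## §2. Boxes of the torus are taxi-star-shaped towards each of their points -/

section Box

variable {P : Params}

/-- ★ **W1's FORWARD CLAUSE `hSf` FOR A BOX** `{y : ∀ μ, (y μ − c μ).val < s μ}` with `2·s μ ≤ N` containing `x′`: from a box point the forward leg towards `x′_μ`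
(taken when it is the shorter way round) stays in the box, endpoint included. [cite: Balaban1985BackgroundPropagators, (3.19) p.393, (3.40) p.397; Balaban1984PropagatorsI, (1.18) p.20] -/
theorem box_taxiStarShaped_fwd (c : Site P 0) (s : Fin P.d → ℕ) (hs : ∀ μ, 2 * s μ ≤ P.sitesPerDir 0) {x' : Site P 0} (hx' : ∀ μ, (x' μ - c μ).val < s μ) :
    ∀ y ∈ {y : Site P 0 | ∀ μ, (y μ - c μ).val < s μ}, ∀ (μ : Fin P.d) (t : ℕ), (x' μ - y μ).val ≤ (y μ - x' μ).val → t ≤ (x' μ - y μ).val →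
      (fun z : Site P 0 => z.shift μ)^[t] y ∈ {y : Site P 0 | ∀ μ, (y μ - c μ).val < s μ} := by
  intro y hy μ t h ht ν
  rw [mem_setOf_eq] at hy
  rw [iterate_shift_apply]
  by_cases hν : ν = μ
  · subst hν
    rw [if_pos rfl]
    have hpq : x' ν - y ν = (x' ν - c ν) - (y ν - c ν) := by ring
    have hqp : y ν - x' ν = (y ν - c ν) - (x' ν - c ν) := by ring
    rw [hpq, hqp] at h; rw [hpq] at ht
    have := val_add_natCast_lt_of_fwd (hs ν) (hy ν) (hx' ν) h ht
    rwa [show y ν + (t : ZMod (P.sitesPerDir 0)) - c ν = y ν - c ν + (t : ZMod (P.sitesPerDir 0)) by ring]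
  · rw [if_neg hν]; exact hy ν

/-- ★ **W1's BACKWARD CLAUSE `hSb` FOR A BOX**. [cite: Balaban1985BackgroundPropagators, (3.19) p.393, (3.40) p.397; Balaban1984PropagatorsI, (1.18) p.20] -/
theorem box_taxiStarShaped_bwd (c : Site P 0) (s : Fin P.d → ℕ) (hs : ∀ μ, 2 * s μ ≤ P.sitesPerDir 0) {x' : Site P 0} (hx' : ∀ μ, (x' μ - c μ).val < s μ) :
    ∀ y ∈ {y : Site P 0 | ∀ μ, (y μ - c μ).val < s μ}, ∀ (μ : Fin P.d) (t : ℕ), ¬ (x' μ - y μ).val ≤ (y μ - x' μ).val → t ≤ (y μ - x' μ).val →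
      (fun z : Site P 0 => z.unshift μ)^[t] y ∈ {y : Site P 0 | ∀ μ, (y μ - c μ).val < s μ} := by
  intro y hy μ t h ht ν
  rw [mem_setOf_eq] at hy
  rw [iterate_unshift_apply]
  by_cases hν : ν = μ
  · subst hν
    rw [if_pos rfl]
    have hpq : x' ν - y ν = (x' ν - c ν) - (y ν - c ν) := by ring
    have hqp : y ν - x' ν = (y ν - c ν) - (x' ν - c ν) := by ring
    rw [hpq, hqp] at h; rw [hqp] at ht
    have := val_sub_natCast_lt_of_bwd (hs ν) (hy ν) (hx' ν) h ht
    rwa [show y ν - (t : ZMod (P.sitesPerDir 0)) - c ν = y ν - c ν - (t : ZMod (P.sitesPerDir 0)) by ring]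
  · rw [if_neg hν]; exact hy ν

end Box

/-! ## §3. ★★ Word-length bounds inside a box, for any configuration -/

section Transport

variable {𝔸 : Type} [NormedRing 𝔸] [NormedAlgebra ℂ 𝔸] [CompleteSpace 𝔸] [NormOneClass 𝔸]
variable {P : Params} (U : CfgV1 P 𝔸) (c : Site P 0) (s : Fin P.d → ℕ) {K : ℝ}

/-- ★★ **`‖U(Γ_{x,x′})‖ ≤ K^{|x − x′|₁}` INSIDE A BOX**: `x, x′` in the box `{y : ∀ μ, (y μ − c μ).val < s μ}` (`2·s μ ≤ N`), `‖U_μ(y)^{±1}‖ ≤ K` for the bonds based at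
box points ⟹ the taxicab transporter obeys the word-length bound with the BOX's constant — for an arbitrary configuration.
[cite: Balaban1985BackgroundPropagators, (3.3) p.391, (3.19) p.393, (3.24) p.394, (3.40) p.397, (3.35)–(3.37) p.396; Balaban1985Averaging, (52)–(55) pp.27–28] -/
theorem norm_parTaxiV_le_pow_of_box (hs : ∀ μ, 2 * s μ ≤ P.sitesPerDir 0)
    (hK : ∀ μ y, (∀ ν, (y ν - c ν).val < s ν) → ‖(U μ y : 𝔸)‖ ≤ K) (hKi : ∀ μ y, (∀ ν, (y ν - c ν).val < s ν) → ‖(((U μ y)⁻¹ : 𝔸ˣ) : 𝔸)‖ ≤ K)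
    {x x' : Site P 0} (hx : ∀ μ, (x μ - c μ).val < s μ) (hx' : ∀ μ, (x' μ - c μ).val < s μ) :
    ‖(parTaxiV U x x' : 𝔸)‖ ≤ K ^ Site.tdist x x' :=
  norm_parTaxiV_le_pow_of_starShaped U {y : Site P 0 | ∀ μ, (y μ - c μ).val < s μ} x' (fun μ y hy => hK μ y hy) (fun μ y hy => hKi μ y hy)
    (box_taxiStarShaped_fwd c s hs hx') (box_taxiStarShaped_bwd c s hs hx') hx

/-- ★★ **… and `‖U(Γ_{x,x′})⁻¹‖ ≤ K^{|x − x′|₁}` inside the box**. [cite: Balaban1985BackgroundPropagators, (3.3), (3.5) p.391, (3.40) p.397, (3.35)–(3.37) p.396] -/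
theorem norm_parTaxiV_inv_le_pow_of_box (hs : ∀ μ, 2 * s μ ≤ P.sitesPerDir 0)
    (hK : ∀ μ y, (∀ ν, (y ν - c ν).val < s ν) → ‖(U μ y : 𝔸)‖ ≤ K) (hKi : ∀ μ y, (∀ ν, (y ν - c ν).val < s ν) → ‖(((U μ y)⁻¹ : 𝔸ˣ) : 𝔸)‖ ≤ K)
    {x x' : Site P 0} (hx : ∀ μ, (x μ - c μ).val < s μ) (hx' : ∀ μ, (x' μ - c μ).val < s μ) :
    ‖(((parTaxiV U x x')⁻¹ : 𝔸ˣ) : 𝔸)‖ ≤ K ^ Site.tdist x x' :=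
  norm_parTaxiV_inv_le_pow_of_starShaped U {y : Site P 0 | ∀ μ, (y μ - c μ).val < s μ} x' (fun μ y hy => hK μ y hy) (fun μ y hy => hKi μ y hy)
    (box_taxiStarShaped_fwd c s hs hx') (box_taxiStarShaped_bwd c s hs hx') hx

end Transport

end Literature.MathematicalPhysics.QuantumFieldTheory.Balaban1983to89.B13TaxiStarShapedBoxes
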